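import Mathlib

/-!
# Finite group actions in which every non-trivial element has exactly two fixed points

Route `LevelGradedCohnUmans`, crux `SubgroupIdentityDesigns` (stmt-MatrixMultiplication-14079), cell
`(m,k) = (2,1)`.  VALUE = THEOREM (elementary group theory), NOT summit progress.  This is the
orbit-counting half of the in-Lean proof of the named hypothesis `DicksonList`
(`DicksonReduction.lean`), stated abstractly: a finite group `Γ` acts on a type `X` with kernel `K`
and every element outside `K` has exactly two fixed points.  Then (`two_point_action`) either
`K = Γ`, or there is a pair `{x, y} = Fix(γ₀)` (`γ₀ ∉ K`) which every element of `Γ` fixes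
pointwise or swaps, or `|Γ| ≤ 60 · |K|`.  Proof: Burnside's lemma and the orbit decomposition on
the finite invariant set `Y` of points fixed by some element outside `K` give
`Σ_O N/e_O = (r - 2) N + 2` over the `r` orbits in `Y` (`N = |Γ/K|`, `e_O ≥ 2`), whose solutions
are `r = 2` (two fixed points), an orbit of size `2`, or `N ∈ {12, 24, 60}`.
-/

set_option linter.dupNamespace false

noncomputable section

open scoped BigOperators Classical

namespace Summit.MatrixMultiplication.MatrixMultiplication.Theorems.SubgroupIdentityDesigns.Negative

section TwoPointActions

open MulAction

variable {Γ : Type*} [Group Γ] {X : Type*} [MulAction Γ X]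

/-- The kernel of an action. -/
def actKer (Γ X : Type*) [Group Γ] [MulAction Γ X] : Subgroup Γ := (MulAction.toPermHom Γ X).ker

/-- Membership in the kernel. -/
theorem mem_actKer {γ : Γ} : γ ∈ actKer Γ X ↔ ∀ x : X, γ • x = x := by
  simp only [actKer, MonoidHom.mem_ker, Equiv.ext_iff, MulAction.toPermHom_apply,
    MulAction.toPerm_apply, Equiv.Perm.one_apply]

/-- The kernel is normal. -/
theorem conj_not_mem_actKer {γ δ : Γ} (hδ : δ ∉ actKer Γ X) : γ * δ * γ⁻¹ ∉ actKer Γ X := by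
  intro h
  apply hδ
  have hn : (actKer Γ X).Normal := by unfold actKer; infer_instance
  have := hn.conj_mem _ h γ⁻¹
  simpa [mul_assoc] using this

/-! ### The arithmetic of `Σ 1/eᵢ = 1 + 2/N` -/

/-- Ordered core case: `e₁ = 2`, `e₂ = 3`. -/
theorem arith3_core {N m₁ m₂ m₃ e₃ : ℕ} (h₁ : m₁ * 2 = N) (h₂ : m₂ * 3 = N) (h₃ : m₃ * e₃ = N)
    (he₃ : 2 ≤ e₃) (hs : m₁ + m₂ + m₃ = N + 2) :
    m₃ = 2 ∨ m₂ = 2 ∨ N = 12 ∨ N = 24 ∨ N = 60 := by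
  have h6 : 6 * m₃ = N + 12 := by omega
  have he : e₃ ≤ 5 := by
    by_contra h
    push Not at h
    nlinarith
  interval_cases e₃ <;> omega

/-- Ordered case: `e₁ = 2`. -/
theorem arith3_half {N m₁ m₂ m₃ e₂ e₃ : ℕ} (h₁ : m₁ * 2 = N) (h₂ : m₂ * e₂ = N)
    (h₃ : m₃ * e₃ = N) (he₂ : 2 ≤ e₂) (he₃ : 2 ≤ e₃) (hs : m₁ + m₂ + m₃ = N + 2) :
    m₁ = 2 ∨ m₂ = 2 ∨ m₃ = 2 ∨ N = 12 ∨ N = 24 ∨ N = 60 := by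
  rcases Nat.lt_or_ge e₂ 3 with l₂ | l₂
  · -- `e₂ = 2`
    have : e₂ = 2 := by omega
    subst this
    right; right; left; omega
  rcases Nat.lt_or_ge e₃ 3 with l₃ | l₃
  · have : e₃ = 2 := by omega
    subst this
    right; left; omega
  rcases Nat.lt_or_ge e₂ 4 with k₂ | k₂
  · have : e₂ = 3 := by omega
    subst this
    rcases arith3_core h₁ h₂ h₃ he₃ hs with h | h | h | h | h
    · exact Or.inr (Or.inr (Or.inl h))
    · exact Or.inr (Or.inl h)
    · exact Or.inr (Or.inr (Or.inr (Or.inl h)))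
    · exact Or.inr (Or.inr (Or.inr (Or.inr (Or.inl h))))
    · exact Or.inr (Or.inr (Or.inr (Or.inr (Or.inr h))))
  rcases Nat.lt_or_ge e₃ 4 with k₃ | k₃
  · have : e₃ = 3 := by omega
    subst this
    have hs' : m₁ + m₃ + m₂ = N + 2 := by omega
    rcases arith3_core h₁ h₃ h₂ he₂ hs' with h | h | h | h | h
    · exact Or.inr (Or.inl h)
    · exact Or.inr (Or.inr (Or.inl h))
    · exact Or.inr (Or.inr (Or.inr (Or.inl h)))
    · exact Or.inr (Or.inr (Or.inr (Or.inr (Or.inl h))))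
    · exact Or.inr (Or.inr (Or.inr (Or.inr (Or.inr h))))
  -- `e₂, e₃ ≥ 4`: impossible
  exfalso
  nlinarith

/-- **The solutions of `1/e₁ + 1/e₂ + 1/e₃ = 1 + 2/N` with `eᵢ ≥ 2`.** -/
theorem arith3 {N m₁ m₂ m₃ e₁ e₂ e₃ : ℕ} (h₁ : m₁ * e₁ = N) (h₂ : m₂ * e₂ = N)
    (h₃ : m₃ * e₃ = N) (he₁ : 2 ≤ e₁) (he₂ : 2 ≤ e₂) (he₃ : 2 ≤ e₃)
    (hs : m₁ + m₂ + m₃ = N + 2) :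
    m₁ = 2 ∨ m₂ = 2 ∨ m₃ = 2 ∨ N = 12 ∨ N = 24 ∨ N = 60 := by
  -- one of the `eᵢ` equals `2`
  rcases Nat.lt_or_ge e₁ 3 with l₁ | l₁
  · have : e₁ = 2 := by omega
    subst this
    exact arith3_half h₁ h₂ h₃ he₂ he₃ hs
  rcases Nat.lt_or_ge e₂ 3 with l₂ | l₂
  · have : e₂ = 2 := by omega
    subst this
    have hs' : m₂ + m₁ + m₃ = N + 2 := by omega
    rcases arith3_half h₂ h₁ h₃ he₁ he₃ hs' with h | h | h
    · exact Or.inr (Or.inl h)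
    · exact Or.inl h
    · exact Or.inr (Or.inr h)
  rcases Nat.lt_or_ge e₃ 3 with l₃ | l₃
  · have : e₃ = 2 := by omega
    subst this
    have hs' : m₃ + m₂ + m₁ = N + 2 := by omega
    rcases arith3_half h₃ h₂ h₁ he₂ he₁ hs' with h | h | h | h
    · exact Or.inr (Or.inr (Or.inl h))
    · exact Or.inr (Or.inl h)
    · exact Or.inl h
    · exact Or.inr (Or.inr (Or.inr h))
  exfalso
  nlinarith

/-! ### Invariant pairs -/

/-- An invariant pair containing a point fixed by a non-kernel element is a fix-or-swap pair. -/
theorem pair_of_invariant_pair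
    (h2 : ∀ γ : Γ, γ ∉ actKer Γ X → ∃ x y : X, x ≠ y ∧ fixedBy X γ = {x, y})
    {x y : X} (hxy : x ≠ y)
    (hinv : ∀ γ : Γ, (γ • x = x ∨ γ • x = y) ∧ (γ • y = x ∨ γ • y = y))
    {γ₀ : Γ} (hγ₀ : γ₀ ∉ actKer Γ X) (hfx : γ₀ • x = x) :
    fixedBy X γ₀ = {x, y} ∧ ∀ γ : Γ, (γ • x = x ∧ γ • y = y) ∨ (γ • x = y ∧ γ • y = x) := by
  have hfy : γ₀ • y = y := by
    rcases (hinv γ₀).2 with h | h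
    · exfalso; apply hxy
      have : γ₀⁻¹ • (γ₀ • y) = γ₀⁻¹ • x := by rw [h]
      rw [inv_smul_smul] at this
      rw [this]; symm; rw [inv_smul_eq_iff, hfx]
    · exact h
  obtain ⟨x', y', hxy', hF⟩ := h2 γ₀ hγ₀
  have hx : x ∈ fixedBy X γ₀ := hfx
  have hy : y ∈ fixedBy X γ₀ := hfy
  rw [hF] at hx hy
  simp only [Set.mem_insert_iff, Set.mem_singleton_iff] at hx hy
  constructor
  · rw [hF]
    rcases hx with rfl | rfl <;> rcases hy with rfl | rfl
    · exact absurd rfl hxy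
    · rfl
    · exact Set.pair_comm _ _
    · exact absurd rfl hxy
  · intro γ
    rcases (hinv γ).1 with h | h <;> rcases (hinv γ).2 with h' | h'
    · exfalso; apply hxy; exact MulAction.injective γ (h.trans h'.symm)
    · exact Or.inl ⟨h, h'⟩
    · exact Or.inr ⟨h, h'⟩
    · exfalso; apply hxy; exact MulAction.injective γ (h.trans h'.symm)

/-! ### The orbit count -/

/-- **Two-point actions.**  If every element outside the kernel `K` has exactly two fixed points,
then `K = Γ`, or some pair `Fix(γ₀)` is fixed-or-swapped by all of `Γ`, or `|Γ| ≤ 60 |K|`. -/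
theorem two_point_action [Fintype Γ]
    (h2 : ∀ γ : Γ, γ ∉ actKer Γ X → ∃ x y : X, x ≠ y ∧ fixedBy X γ = {x, y}) :
    actKer Γ X = ⊤ ∨
    (∃ x y : X, x ≠ y ∧ (∃ γ₀ : Γ, γ₀ ∉ actKer Γ X ∧ fixedBy X γ₀ = {x, y}) ∧
        ∀ γ : Γ, (γ • x = x ∧ γ • y = y) ∨ (γ • x = y ∧ γ • y = x)) ∨
    Nat.card Γ ≤ 60 * Nat.card (actKer Γ X) := by
  set K := actKer Γ X with hKdef
  by_cases hKtop : K = ⊤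
  · exact Or.inl hKtop
  right
  -- the invariant finite set `Y`
  set Y : Set X := {x | ∃ γ : Γ, γ ∉ K ∧ γ • x = x} with hYdef
  have hYfin : Y.Finite := by
    have : Y ⊆ ⋃ γ : Γ, (if γ ∈ K then (∅ : Set X) else fixedBy X γ) := by
      rintro x ⟨γ, hγ, hx⟩
      simp only [Set.mem_iUnion]
      exact ⟨γ, by rw [if_neg hγ]; exact hx⟩
    refine Set.Finite.subset (Set.finite_iUnion fun γ => ?_) this
    split_ifs with h
    · exact Set.finite_empty
    · obtain ⟨x, y, -, hF⟩ := h2 γ h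
      rw [hF]; exact (Set.finite_singleton y).insert x
  have hYinv : ∀ (γ : Γ) {x : X}, x ∈ Y → γ • x ∈ Y := by
    rintro γ x ⟨δ, hδ, hx⟩
    exact ⟨γ * δ * γ⁻¹, conj_not_mem_actKer hδ, by rw [mul_smul, mul_smul, inv_smul_smul, hx]⟩
  let S : SubMulAction Γ X := ⟨Y, fun γ _ hx => hYinv γ hx⟩
  haveI : Fintype S := hYfin.fintype
  have hSval : ∀ (γ : Γ) (s : S), ((γ • s : S) : X) = γ • (s : X) := fun γ s => rfl
  -- kernel elements fix `S` pointwise; stabilisers contain `K`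
  have hKfix : ∀ γ ∈ K, ∀ s : S, γ • s = s := by
    intro γ hγ s
    apply Subtype.ext
    rw [hSval]; exact (mem_actKer.mp hγ) _
  -- Burnside on `S`
  have hB := MulAction.sum_card_fixedBy_eq_card_orbits_mul_card_group Γ S
  simp only [← Nat.card_eq_fintype_card] at hB
  set r := Nat.card (Quotient (orbitRel Γ S)) with hrdef
  have hfix_in : ∀ γ ∈ K, Nat.card (fixedBy S γ) = Nat.card S := by
    intro γ hγ
    have : fixedBy S γ = Set.univ := by
      ext s; simp only [MulAction.mem_fixedBy, Set.mem_univ, iff_true]; exact hKfix γ hγ s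
    rw [this, Nat.card_congr (Equiv.Set.univ S)]
  have hfix_out : ∀ γ, γ ∉ K → Nat.card (fixedBy S γ) = 2 := by
    intro γ hγ
    obtain ⟨x, y, hxy, hF⟩ := h2 γ hγ
    have hx : x ∈ fixedBy X γ := by rw [hF]; exact Set.mem_insert _ _
    have hy : y ∈ fixedBy X γ := by rw [hF]; exact Set.mem_insert_of_mem _ rfl
    have hxY : x ∈ Y := ⟨γ, hγ, hx⟩
    have hyY : y ∈ Y := ⟨γ, hγ, hy⟩
    have hxS : (⟨x, hxY⟩ : S) ∈ fixedBy S γ := Subtype.ext hx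
    have hyS : (⟨y, hyY⟩ : S) ∈ fixedBy S γ := Subtype.ext hy
    rw [Nat.card_eq_two_iff]
    refine ⟨⟨_, hxS⟩, ⟨_, hyS⟩, ?_, ?_⟩
    · intro h
      apply hxy
      have := congrArg (fun a : fixedBy S γ => ((a : S) : X)) h
      exact this
    · rw [Set.eq_univ_iff_forall]
      intro a
      have ha : ((a : S) : X) ∈ fixedBy X γ := by
        have := a.2
        rw [MulAction.mem_fixedBy] at this
        have := congrArg (fun s : S => (s : X)) this
        simpa [hSval] using this
      rw [hF] at ha
      simp only [Set.mem_insert_iff, Set.mem_singleton_iff] at ha ⊢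
      rcases ha with ha | ha
      · left; exact Subtype.ext (Subtype.ext ha)
      · right; exact Subtype.ext (Subtype.ext ha)
  -- evaluate the Burnside sum
  set k := Nat.card K with hkdef
  set n := Nat.card Γ with hndef
  set c := (Finset.univ.filter fun γ : Γ => γ ∉ K).card with hcdef
  have hkc : k + c = n := by
    have hk' : k = (Finset.univ.filter fun γ : Γ => γ ∈ K).card := by
      rw [hkdef, Nat.card_eq_fintype_card, Fintype.card_subtype]
    rw [hk', hcdef, Finset.card_filter_add_card_filter_not, Finset.card_univ, hndef,
      Nat.card_eq_fintype_card]
  have hsum : ∑ γ : Γ, Nat.card (fixedBy S γ) = Nat.card S * k + 2 * c := by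
    have : ∀ γ : Γ, Nat.card (fixedBy S γ) = if γ ∈ K then Nat.card S else 2 := by
      intro γ; split_ifs with h
      · exact hfix_in γ h
      · exact hfix_out γ h
    simp_rw [this]
    rw [Finset.sum_ite, Finset.sum_const, Finset.sum_const, smul_eq_mul, smul_eq_mul]
    have hk' : (Finset.univ.filter fun γ : Γ => γ ∈ K).card = k := by
      rw [hkdef, Nat.card_eq_fintype_card, Fintype.card_subtype]
    rw [hk', ← hcdef]; ring
  rw [hsum] at hB
  -- `n = k * N`
  have hkpos : 0 < k := Nat.card_pos
  obtain ⟨N, hN⟩ : k ∣ n := Subgroup.card_subgroup_dvd_card K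
  have hN2 : 2 ≤ N := by
    by_contra hlt
    push Not at hlt
    apply hKtop
    apply Subgroup.eq_top_of_le_card
    rw [← hndef, ← hkdef, hN]
    interval_cases N <;> omega
  -- orbit decomposition of `S`
  have hO : Nat.card S = ∑ ω : Quotient (orbitRel Γ S), Nat.card (orbit Γ ω.out) := by
    rw [Nat.card_eq_fintype_card, Fintype.card_congr (MulAction.selfEquivSigmaOrbits Γ S),
      Fintype.card_sigma]
    simp only [← Nat.card_eq_fintype_card]
  -- per-orbit data
  have horb : ∀ ω : Quotient (orbitRel Γ S),
      ∃ e : ℕ, 2 ≤ e ∧ Nat.card (orbit Γ ω.out) * e = N := by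
    intro ω
    set s : S := ω.out with hsdef
    have hKle : K ≤ stabilizer Γ s := fun γ hγ => hKfix γ hγ s
    obtain ⟨e, he⟩ : k ∣ Nat.card (stabilizer Γ s) := Subgroup.card_dvd_of_le hKle
    have hos : Nat.card (orbit Γ s) * Nat.card (stabilizer Γ s) = n := by
      rw [hndef, Nat.card_eq_fintype_card, Nat.card_eq_fintype_card, Nat.card_eq_fintype_card]
      exact MulAction.card_orbit_mul_card_stabilizer_eq_card_group Γ s
    -- `e ≠ 1`: some non-kernel element fixes `s`
    have he1 : e ≠ 1 := by
      intro h1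
      rw [h1, mul_one] at he
      have hKeq : K = stabilizer Γ s := Subgroup.eq_of_le_of_card_ge hKle (by rw [he])
      obtain ⟨δ, hδ, hδs⟩ := s.2
      apply hδ
      rw [hKeq, MulAction.mem_stabilizer_iff]
      exact Subtype.ext hδs
    have he0 : e ≠ 0 := by
      intro h0; rw [h0, mul_zero] at he
      exact (Nat.card_pos (α := stabilizer Γ s)).ne' he
    refine ⟨e, by omega, ?_⟩
    rw [he, hN] at hos
    -- `m * (k * e) = k * N`
    have : k * (Nat.card (orbit Γ s) * e) = k * N := by rw [← hos]; ring
    exact Nat.eq_of_mul_eq_mul_left hkpos this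
  choose e he2 hme using horb
  -- the two counting identities
  have hI : Nat.card S + 2 * N = r * N + 2 := by
    have h1 : Nat.card S * k + 2 * c = r * n := hB
    rw [hN] at h1 hkc
    have : k * (Nat.card S + 2 * N) = k * (r * N + 2) := by nlinarith [h1, hkc]
    exact Nat.eq_of_mul_eq_mul_left hkpos this
  have hm1 : ∀ ω : Quotient (orbitRel Γ S), 1 ≤ Nat.card (orbit Γ ω.out) := by
    intro ω
    have := hme ω
    by_contra h; push Not at h
    have h0 : Nat.card (orbit Γ ω.out) = 0 := by omega
    rw [h0, zero_mul] at this; omega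
  have hm2 : ∀ ω : Quotient (orbitRel Γ S), 2 * Nat.card (orbit Γ ω.out) ≤ N := by
    intro ω; have := hme ω; have := he2 ω; nlinarith
  have hcardΩ : (Finset.univ : Finset (Quotient (orbitRel Γ S))).card = r := by
    rw [Finset.card_univ, hrdef, Nat.card_eq_fintype_card]
  have hr_le : r ≤ Nat.card S := by
    have := Finset.card_nsmul_le_sum (Finset.univ : Finset (Quotient (orbitRel Γ S)))
      (fun ω => Nat.card (orbit Γ ω.out)) 1 (fun ω _ => hm1 ω)
    rw [hcardΩ, smul_eq_mul, mul_one] at this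
    rw [hO]; exact this
  have hr_ge : 2 * Nat.card S ≤ r * N := by
    have := Finset.sum_le_card_nsmul (Finset.univ : Finset (Quotient (orbitRel Γ S)))
      (fun ω => 2 * Nat.card (orbit Γ ω.out)) N (fun ω _ => hm2 ω)
    rw [hcardΩ, smul_eq_mul] at this
    rw [hO, Finset.mul_sum]; exact this
  have hr3 : r ≤ 3 := by nlinarith
  have hr2 : 2 ≤ r := by nlinarith
  -- an orbit of size two in `S` is an invariant pair
  have horb2 : ∀ s₀ : S, Nat.card (orbit Γ s₀) = 2 →
      ∃ x y : X, x ≠ y ∧ (∃ γ₀ : Γ, γ₀ ∉ actKer Γ X ∧ fixedBy X γ₀ = {x, y}) ∧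
        ∀ γ : Γ, (γ • x = x ∧ γ • y = y) ∨ (γ • x = y ∧ γ • y = x) := by
    intro s₀ h
    obtain ⟨a, b, hab, huniv2⟩ := Nat.card_eq_two_iff.mp h
    have hab' : ((a : S) : X) ≠ ((b : S) : X) := by
      intro hh; apply hab; apply Subtype.ext; apply Subtype.ext; exact hh
    have hax : ∀ γ : Γ, ∀ t : orbit Γ s₀,
        ((γ • (t : S) : S) : X) = (a : S) ∨ ((γ • (t : S) : S) : X) = (b : S) := by
      intro γ t
      have hmem : γ • (t : S) ∈ orbit Γ s₀ := by
        obtain ⟨δ, hδ⟩ := MulAction.mem_orbit_iff.mp t.2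
        exact MulAction.mem_orbit_iff.mpr ⟨γ * δ, by rw [mul_smul, hδ]⟩
      have : (⟨γ • (t : S), hmem⟩ : orbit Γ s₀) ∈ ({a, b} : Set (orbit Γ s₀)) := by
        rw [huniv2]; exact Set.mem_univ _
      simp only [Set.mem_insert_iff, Set.mem_singleton_iff] at this
      rcases this with hh | hh
      · left; have := congrArg (fun u : orbit Γ s₀ => ((u : S) : X)) hh; exact this
      · right; have := congrArg (fun u : orbit Γ s₀ => ((u : S) : X)) hh; exact this
    obtain ⟨γ₀, hγ₀, hγ₀a⟩ := (a : S).2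
    have hinv : ∀ γ : Γ, (γ • ((a : S) : X) = (a : S) ∨ γ • ((a : S) : X) = (b : S)) ∧
        (γ • ((b : S) : X) = (a : S) ∨ γ • ((b : S) : X) = (b : S)) :=
      fun γ => ⟨by rw [← hSval]; exact hax γ a, by rw [← hSval]; exact hax γ b⟩
    obtain ⟨hF, hall⟩ := pair_of_invariant_pair h2 hab' hinv hγ₀ hγ₀a
    exact ⟨_, _, hab', ⟨γ₀, hγ₀, hF⟩, hall⟩
  -- case `r = 2`: `Y` itself is an invariant pair
  rcases Nat.lt_or_ge r 3 with hr | hr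
  · have hr' : r = 2 := by omega
    have hS2 : Nat.card S = 2 := by rw [hr'] at hI; omega
    obtain ⟨a, b, hab, huniv⟩ := Nat.card_eq_two_iff.mp hS2
    left
    have hax : ∀ γ : Γ, ∀ s : S, ((γ • s : S) : X) = a ∨ ((γ • s : S) : X) = b := by
      intro γ s
      have : γ • s ∈ ({a, b} : Set S) := by rw [huniv]; exact Set.mem_univ _
      simp only [Set.mem_insert_iff, Set.mem_singleton_iff] at this
      rcases this with h | h
      · left; rw [h]
      · right; rw [h]
    have hab' : (a : X) ≠ b := fun h => hab (Subtype.ext h)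
    obtain ⟨γ₀, hγ₀, hγ₀a⟩ := a.2
    have hinv : ∀ γ : Γ, (γ • (a : X) = a ∨ γ • (a : X) = b) ∧
        (γ • (b : X) = a ∨ γ • (b : X) = b) :=
      fun γ => ⟨by rw [← hSval]; exact hax γ a, by rw [← hSval]; exact hax γ b⟩
    obtain ⟨hF, hall⟩ := pair_of_invariant_pair h2 hab' hinv hγ₀ hγ₀a
    exact ⟨a, b, hab', ⟨γ₀, hγ₀, hF⟩, hall⟩
  -- case `r = 3`
  have hr' : r = 3 := by omega
  have hS3 : Nat.card S = N + 2 := by rw [hr'] at hI; omega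
  have hcard3 : (Finset.univ : Finset (Quotient (orbitRel Γ S))).card = 3 := by
    rw [hcardΩ]; exact hr'
  obtain ⟨ω₁, ω₂, ω₃, h12, h13, h23, huniv⟩ := Finset.card_eq_three.mp hcard3
  have hsum3 : Nat.card (orbit Γ ω₁.out) + Nat.card (orbit Γ ω₂.out) +
      Nat.card (orbit Γ ω₃.out) = N + 2 := by
    rw [← hS3, hO, huniv, Finset.sum_insert (by simp [h12, h13]),
      Finset.sum_insert (by simp [h23]), Finset.sum_singleton]
    ring
  rcases arith3 (hme ω₁) (hme ω₂) (hme ω₃) (he2 ω₁) (he2 ω₂) (he2 ω₃) hsum3 with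
    h | h | h | h | h | h
  · left; exact horb2 _ h
  · left; exact horb2 _ h
  · left; exact horb2 _ h
  · right; rw [hN, h]; omega
  · right; rw [hN, h]; omega
  · right; rw [hN, h]; omega

end TwoPointActions

end Summit.MatrixMultiplication.MatrixMultiplication.Theorems.SubgroupIdentityDesigns.Negative

end
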